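import Summits.QuantumFields.YangMills.Theses.BalabanLadder
import Summits.QuantumFields.YangMills.Theorems.BalabanLadderUVOtherGroupsDefs
import Summits.QuantumFields.YangMills.Theorems.BalabanLadderClosesKit
import HarnessLib

/-!
# Route `BalabanLadder`, crux `UVOtherGroups` (stmt-QuantumFields-19356): the other-groups closers STAGED OVER `ROT` rev 2′ (and rev 1 by name)

Helper file (`--supports stmt-QuantumFields-19356`, fleet seat `ym-osasm-p2`, director-ym R136 (iii)); PURE THEOREMS, count-neutral.
HONEST FRAMING: glue of a conditional chain — nothing of Bałaban's programme, no seam, no residual is discharged; not a gap, not Clay.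

WHY (route owner ★ym-beyond-p2 RULING R25, 2026-08-27T02:29:20Z, checklist [R2] «osasm-p2's OtherGroups twins staged over rev 2′»;
★ym-osasm-p1 `R85-BODY-DEPS.md` 679b246d82a64b1a, binder `ROT`, 13 body-dependent declarations).  The R85 batch restates the route decl
`Theses.BalabanLadder.ROT` from its rev-1 text (named, `Theses`-free copy `Theorems.ROT.ROTRev1`, character-identical) to the rev-2′ text of
record (named copy `Theorems.ROT.ROTRev2'`, character-identical).  Two closers of this seat's cone UNFOLD `ROT` and therefore stop elaborating
at that restate: `Theorems.UVOtherGroups.yangMills_of_witnessSplit` (`…UVOtherGroupsSUN` §6) and `Theorems.UVOtherGroups.yangMills_of_recordSplit`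
(`…UVOtherGroupsWitness`).  This module lands their TWINS over the two revisions BY NAME, today, in a module that survives the whole batch:

* EDIT-SAFETY.  Imports = the route file (re-rendered by the edit itself) + `…UVOtherGroupsDefs` (closure `Theses`-free since the R201 leaf
  split: `…BalabanUVNodesClustersCore` no longer imports the route file) + `…BalabanLadderClosesKit` (closure `Theses`-free, 888 modules).
  No theorem below unfolds `UV` (item 1 restates its text) or `ROT` (item 3): `hUV : UV` is passed OPAQUELY to `UVSeamRec`, and the rotation
  leg is typed `Theorems.ROT.ROTRev2'` ∕ `Theorems.ROT.ROTRev1`.  The route decls that ARE unfolded — `UVSeamRec`, `NT`, `IR` — keep their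
  texts in the batch (`R85-BATCH-EDITS` rev 3e Δ3 ∕ item 2b: `NT` becomes an aside = kind change, text byte-identical, precedent `UVSeam` rev 1;
  `IR` untouched).  Hence nothing here is on any body-dependence list of the batch.
* NOT `UVSUN`-HEADED.  The landed `yangMills_of_witnessSplit` feeds the `SU(2)` class through `uv_of_uvSUN : UVSUN → UV`, whose proof is the
  D-0061 identity `YMDAG.UVSplit.uvD59_two_iff` with TODAY's text of `UV`; after item 1 that junction must be re-derived against the E1 text
  (owner checklist [R1], not decidable today).  The twins below therefore take `hUV : UV` and the `SU(N ≥ 3)` apex keys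
  `∀ N ≥ 3, YMDAG.UVSplit.UVD59 N` (= the planned item `UVApexSUN`, spelling (S0), `Iff.rfl`) separately (from `hSUN : UVSUN` the keys are
  `fun N _ hN => hSUN N (by omega)`).

CONTENTS.
* §1 `nonSUNRec_of_nt_of_uvNonSUN` — the ∀-shape residual `UVNonSUN` fed by `NT` gives the RECORD-form residual (the text of the planned item
  `UVNonSUNRec`).
* §2 THE 8-BINDER BODIES (owner's FALLBACK (B) of item 2b: `NT` kept, residual in ∀-shape) over rev 2′ and rev 1:
  `yangMills_of_witnessSplit8_rotRev2'`, `yangMills_of_witnessSplit8_rotRev1` — `UV → UVSeamRec → (∀ N ≥ 3, UVD59 N) → UVSeamWitnessSUN → NT →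
  UVNonSUN → IR → ROTRev2' ∕ ROTRev1 → YangMills`.
* §3 THE 7-BINDER BODIES OF RECORD (item 2 as ruled: record residual, `NT` in no branch) over rev 2′ and rev 1:
  `yangMills_of_recordSplit_rotRev2'` (= the batch `closes` of Δ6 with the route's `hSeam hUV`, `hWit N hN (hApex N hN)` lambdas already applied),
  `yangMills_of_recordSplit_rotRev1` (= the landed `yangMills_of_recordSplit`, whose `hROT : ROT` is `ROTRev1` definitionally today).
All four are ONE application of the cycle-free kit (`BalabanLadderGlue.legsWitnessAll_of_pieces`, `yangMills_of_legsWitnessAll_rotRev2'` ∕ `_rotRev1`).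

AT THE EDIT HOUR (operator ∕ buildfix pen; this seat's desk memo `R85-REPAIR-BYTES-osasm-p2.md`): the two RED closers are repaired either by
RE-TYPING `hROT : Theses.BalabanLadder.ROT ↦ Theorems.ROT.ROTRev1` (proof bytes unchanged) or by RE-PROVING them as stated over the restated
decl in one line from §3 ∕ §2 here (`hROT : ROT` then unfolds to `ROTRev2'`).

Refs: owner `pub/ym-beyond/p2-g21-files/R85-BATCH-EDITS.md` rev 3e items 2 ∕ 2b ∕ 3 ∕ 5b, `p2-g23-files/R85-BATCH-EDITS-rev3g-delta.md` Δ6–Δ8,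
`p2-g24-files/posts-r25-r85-sequencing.md` (R25); C. King, Commun. Math. Phys. 103 (1986) Thm 2.4 (the rev-2′ class device, mechanism only);
folklore (Haar transport, trichotomy of compact simple groups by `SU(N)`-classes).
-/

set_option autoImplicit false

noncomputable section

open MeasureTheory Filter Topology
open Literature.MathematicalPhysics.QuantumFieldTheory
open Summit.QuantumFields.YangMills.Cruxes.OSLegsFromFemtoAndGap.DlrCollarTransfer
open Summit.QuantumFields.YangMills.Theorems.ROT (ROTRev1 ROTRev2')
open Summit.QuantumFields.YangMills.Theorems.BalabanLadderGlue
  (legsWitnessAll_of_pieces yangMills_of_legsWitnessAll_rotRev2' yangMills_of_legsWitnessAll_rotRev1)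

namespace Summit.QuantumFields.YangMills.Theorems.UVOtherGroups

/-! ## §1 The residual in record form from today's pair -/

/-- **`NT` + the ∀-shape residual `UVNonSUN` give the record-form residual** (the text of the planned item `UVNonSUNRec`): for a compact simple
`G` admitting no `G ≃ₜ* SU(N)` (`N ≥ 2`), the spine's `NT` witness `(r, a)` carries the floors and `UVNonSUN` adds the ceilings at the same
`(r, a)`.  Monotonicity of the owner's item-2 edit on the residual side (today's pair ⇒ the record piece). [folklore; glue] -/
theorem nonSUNRec_of_nt_of_uvNonSUN (hNT : Summit.QuantumFields.YangMills.Theses.BalabanLadder.NT) (hNon : UVNonSUN) :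
    ∀ (G : Type) [Group G] [TopologicalSpace G] [IsTopologicalGroup G] [CompactSpace G],
      IsCompactSimpleLieGroup G → (∀ N : ℕ, 2 ≤ N → IsEmpty (G ≃ₜ* Matrix.specialUnitaryGroup (Fin N) ℂ)) →
      letI : MeasurableSpace G := borel G; haveI : BorelSpace G := ⟨rfl⟩;
      ∃ (r : LatticeRep G) (a : ℝ → ℝ), (∀ β, 0 < a β) ∧ Tendsto a atTop (𝓝 0) ∧ LowerBounds G r a ∧ MomentBounds6 G r a := by
  intro G _ _ _ _ hG hno
  letI : MeasurableSpace G := borel G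
  haveI : BorelSpace G := ⟨rfl⟩
  obtain ⟨r, a, ha, ha0, hlb⟩ := hNT G hG
  exact ⟨r, a, ha, ha0, hlb, hNon G hG hno r a ha ha0 hlb⟩

/-! ## §2 The 8-binder bodies (fallback (B): `NT` kept, residual in ∀-shape) over the two revisions of `ROT` -/

/-- **`YangMills` through the witness split, rotation leg REV 2′** — `UV → UVSeamRec → (∀ N ≥ 3, UVD59 N) → UVSeamWitnessSUN → NT → UVNonSUN →
IR → Theorems.ROT.ROTRev2' → YangMills`: the `SU(2)` class by `UVSeamRec` applied to `hUV` (unit of record), the `SU(N ≥ 3)` classes by the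
witness-form seam under the apex keys (Haar transport inside the kit), every other compact simple `G` by `NT` + `UVNonSUN`; then the text of `IR`
and the rev-2′ rotation leg through the PROVED class bridge (`BalabanLadderGlue.yangMills_of_legsWitnessAll_rotRev2'`).  The twin of the landed
`yangMills_of_witnessSplit` that survives the R85 restates (`hUV` opaque, `ROT` by its Theorems name).  Conditional on all eight hypotheses;
nothing is discharged. [folklore; glue] -/
theorem yangMills_of_witnessSplit8_rotRev2' (hUV : Summit.QuantumFields.YangMills.Theses.BalabanLadder.UV)
    (hSeamRec : Summit.QuantumFields.YangMills.Theses.BalabanLadder.UVSeamRec)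
    (hApex : ∀ (N : ℕ) [NeZero N], 3 ≤ N → YMDAG.UVSplit.UVD59 N) (hWit : UVSeamWitnessSUN)
    (hNT : Summit.QuantumFields.YangMills.Theses.BalabanLadder.NT) (hNon : UVNonSUN)
    (hIR : Summit.QuantumFields.YangMills.Theses.BalabanLadder.IR) (hROT : ROTRev2') : YangMills :=
  yangMills_of_legsWitnessAll_rotRev2'
    (legsWitnessAll_of_pieces (fun G _ _ _ _ hG h => hSeamRec hUV G hG h) (fun N _ hN => hWit N hN (hApex N hN))
      (nonSUNRec_of_nt_of_uvNonSUN hNT hNon))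
    hIR hROT

/-- **The same with the rotation leg REV 1 by name** (`Theorems.ROT.ROTRev1` = the text of `Theses.BalabanLadder.ROT` as filed in route revisions
1–9, so TODAY `hROT : ROT` is accepted here definitionally), through the all-schemes bridge (`BalabanLadderGlue.yangMills_of_legsWitnessAll_rotRev1`).
[folklore; glue] -/
theorem yangMills_of_witnessSplit8_rotRev1 (hUV : Summit.QuantumFields.YangMills.Theses.BalabanLadder.UV)
    (hSeamRec : Summit.QuantumFields.YangMills.Theses.BalabanLadder.UVSeamRec)
    (hApex : ∀ (N : ℕ) [NeZero N], 3 ≤ N → YMDAG.UVSplit.UVD59 N) (hWit : UVSeamWitnessSUN)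
    (hNT : Summit.QuantumFields.YangMills.Theses.BalabanLadder.NT) (hNon : UVNonSUN)
    (hIR : Summit.QuantumFields.YangMills.Theses.BalabanLadder.IR) (hROT : ROTRev1) : YangMills :=
  yangMills_of_legsWitnessAll_rotRev1
    (legsWitnessAll_of_pieces (fun G _ _ _ _ hG h => hSeamRec hUV G hG h) (fun N _ hN => hWit N hN (hApex N hN))
      (nonSUNRec_of_nt_of_uvNonSUN hNT hNon))
    hIR hROT

/-! ## §3 The 7-binder bodies of record (item 2 as ruled: record residual, `NT` in no branch) over the two revisions of `ROT` -/

/-- **`YangMills` from the record split, rotation leg REV 2′** — `UV → UVSeamRec → (∀ N ≥ 3, UVD59 N) → UVSeamWitnessSUN → ‹non-SU(N) residual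
in record form› → IR → Theorems.ROT.ROTRev2' → YangMills`: the R85 batch `closes` of record (rev 3g Δ6) with the two route-file lambdas
`fun G _ _ _ _ hG h => hSeam hUV G hG h` and `fun N _ hN => hWit N hN (hApex N hN)` already applied — one application of
`BalabanLadderGlue.yangMills_of_pieces_rotRev2'`'s parts.  The twin of the landed `yangMills_of_recordSplit` that survives the restates; after the
edit `hROT : ROT` unfolds to `ROTRev2'` and the planned items `UVApexSUN` ∕ `UVSeamWitnessSUN` ∕ `UVNonSUNRec` unfold to binders 3 ∕ 4 ∕ 5.
Conditional on all seven hypotheses; nothing is discharged. [folklore; glue] -/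
theorem yangMills_of_recordSplit_rotRev2' (hUV : Summit.QuantumFields.YangMills.Theses.BalabanLadder.UV)
    (hSeamRec : Summit.QuantumFields.YangMills.Theses.BalabanLadder.UVSeamRec)
    (hApex : ∀ (N : ℕ) [NeZero N], 3 ≤ N → YMDAG.UVSplit.UVD59 N) (hWit : UVSeamWitnessSUN)
    (hNonRec : ∀ (G : Type) [Group G] [TopologicalSpace G] [IsTopologicalGroup G] [CompactSpace G],
      IsCompactSimpleLieGroup G → (∀ N : ℕ, 2 ≤ N → IsEmpty (G ≃ₜ* Matrix.specialUnitaryGroup (Fin N) ℂ)) →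
      letI : MeasurableSpace G := borel G; haveI : BorelSpace G := ⟨rfl⟩;
      ∃ (r : LatticeRep G) (a : ℝ → ℝ), (∀ β, 0 < a β) ∧ Tendsto a atTop (𝓝 0) ∧ LowerBounds G r a ∧ MomentBounds6 G r a)
    (hIR : Summit.QuantumFields.YangMills.Theses.BalabanLadder.IR) (hROT : ROTRev2') : YangMills :=
  yangMills_of_legsWitnessAll_rotRev2'
    (legsWitnessAll_of_pieces (fun G _ _ _ _ hG h => hSeamRec hUV G hG h) (fun N _ hN => hWit N hN (hApex N hN)) hNonRec)
    hIR hROT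

/-- **The same with the rotation leg REV 1 by name** (TODAY `hROT : ROT` is accepted here definitionally; this is the landed
`yangMills_of_recordSplit` re-proved over the cycle-free kit, all-schemes bridge). [folklore; glue] -/
theorem yangMills_of_recordSplit_rotRev1 (hUV : Summit.QuantumFields.YangMills.Theses.BalabanLadder.UV)
    (hSeamRec : Summit.QuantumFields.YangMills.Theses.BalabanLadder.UVSeamRec)
    (hApex : ∀ (N : ℕ) [NeZero N], 3 ≤ N → YMDAG.UVSplit.UVD59 N) (hWit : UVSeamWitnessSUN)
    (hNonRec : ∀ (G : Type) [Group G] [TopologicalSpace G] [IsTopologicalGroup G] [CompactSpace G],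
      IsCompactSimpleLieGroup G → (∀ N : ℕ, 2 ≤ N → IsEmpty (G ≃ₜ* Matrix.specialUnitaryGroup (Fin N) ℂ)) →
      letI : MeasurableSpace G := borel G; haveI : BorelSpace G := ⟨rfl⟩;
      ∃ (r : LatticeRep G) (a : ℝ → ℝ), (∀ β, 0 < a β) ∧ Tendsto a atTop (𝓝 0) ∧ LowerBounds G r a ∧ MomentBounds6 G r a)
    (hIR : Summit.QuantumFields.YangMills.Theses.BalabanLadder.IR) (hROT : ROTRev1) : YangMills :=
  yangMills_of_legsWitnessAll_rotRev1
    (legsWitnessAll_of_pieces (fun G _ _ _ _ hG h => hSeamRec hUV G hG h) (fun N _ hN => hWit N hN (hApex N hN)) hNonRec)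
    hIR hROT

end Summit.QuantumFields.YangMills.Theorems.UVOtherGroups

end
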